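import Literature.Analysis.FluidPDE.NSCoriolisTorus
import Literature.Analysis.FunctionSpaces.TorusClassicalNSRestart
import HarnessLib

/-!
# Gluing periodic classical solutions of the rotating Navier–Stokes system in time

Analysis/FluidPDE proof file (theorems only; no definitions, no named facts), sequel of
`NSCoriolisTorus.lean`, supporting the named fact
`Literature.Analysis.FluidPDE.bmn1999_rotating_ns_global_regularity` (Babin–Mahalov–Nicolaenko,
Indiana Univ. Math. J. 48 (1999), Thm. 1.1 = Thm. 5.3, whose proof covers `[0, ∞)` by restarting
the regular solution on successive windows `[kT_σ, (k+1)T_σ]` and identifying the pieces,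
pp. 1170–1171, "bootstrapping … as in Thm. 8.2 of [9]").

The tree glues classical Navier–Stokes solutions on the torus along an open overlap for a
**fixed** force (`Torus.IsClassicalNSSolutionOn.glue_Ioi`, `….glue_Ioo`,
`TorusClassicalNSGluing` / `TorusClassicalNSRestart`). Read on the torus, a periodic classical
solution of the rotating system `∂ₜu + (u·∇)u + Ω e₃ × u = νΔu − ∇p + f` is a Navier–Stokes
solution with the *solution-dependent* force `f − Ω e₃ × u`
(`IsClassicalNSCoriolisSolutionOn.to_torus`), so two pieces carry two different forces. The
remedy is elementary: the force enters the notion of classical solution only through the momentum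
equation at times of the time set (`Torus.isClassicalNSSolutionOn_congr_force`), and both pieces
are solutions for the common force `f − Ω e₃ × U` built from the glued velocity `U` (the pieces
agree on the overlap). Hence:

* `IsClassicalNSCoriolisSolutionOn.torus_glue_Ioo` — pieces on `(c, T)` and `(a, b)`,
  `c ≤ a < T ≤ b`, with equal velocities on `(a, T)`, glue (velocity of the first before `T`, of
  the second from `T` on; pressures normalised at a base point) to a periodic classical solution
  of the rotating system on `(c, b)`;
* `IsClassicalNSCoriolisSolutionOn.torus_glue_Ioi` — the same with second piece on `(a, ∞)` and
  conclusion on `(c, ∞)`.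

## Mathlib / tree search

Tree (reused): `Torus.IsClassicalNSSolutionOn.glue_Ioo`, `….glue_Ioi`
(`TorusClassicalNSRestart`, `TorusClassicalNSGluing`), `IsClassicalNSCoriolisSolutionOn.to_torus`,
`….of_torus` (`NSCoriolisTorus`). Nothing on gluing with state-dependent forces (searched `glue`
with `force`, `congr_force`).

## References

* A. Babin, A. Mahalov, B. Nicolaenko, Indiana Univ. Math. J. 48 (1999) 1133–1176, proof of
  Thm. 5.3, pp. 1170–1171. [BabinMahalovNicolaenko1999]
* J. C. Robinson, J. L. Rodrigo, W. Sadowski, *The Three-Dimensional Navier–Stokes Equations.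
  Classical Theory*, CUP 2016, §8.1 (restart and identification on the overlap).
  [RobinsonRodrigoSadowskiCUP2016]
-/

noncomputable section

open MeasureTheory Set Function Filter Topology
open scoped ContDiff InnerProductSpace RealInnerProductSpace

namespace Literature.Analysis.FluidPDE

/-! ### The force enters only through the momentum equation on the time set -/

/-- **Changing the force off the solution is free**: if `(u, p)` is a classical Navier–Stokes
solution on the torus for the force `f₁` on the time set `S`, and `f₂(t, ·) = f₁(t, ·)` for every
`t ∈ S`, then it is one for `f₂` (the force enters `Torus.IsClassicalNSSolutionOn` only through
the momentum equation at times of `S`). [folklore] -/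
theorem Torus.isClassicalNSSolutionOn_congr_force {d : Type*} [Fintype d] [DecidableEq d]
    {S : Set ℝ} {ν : ℝ} {f₁ f₂ u : ℝ → UnitAddTorus d → EuclideanSpace ℝ d}
    {p : ℝ → UnitAddTorus d → ℝ} (h : FunctionSpaces.Torus.IsClassicalNSSolutionOn S ν f₁ u p)
    (hf : ∀ t ∈ S, ∀ x, f₂ t x = f₁ t x) : FunctionSpaces.Torus.IsClassicalNSSolutionOn S ν f₂ u p where
  smooth_velocity := h.smooth_velocity
  smooth_pressure := h.smooth_pressure
  momentum t ht x := by
    rw [hf t ht x]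
    exact h.momentum t ht x
  divFree := h.divFree

namespace IsClassicalNSCoriolisSolutionOn

variable {ν Ω : ℝ} {f u₁ u₂ : ℝ → UnitAddTorus (Fin 3) → EuclideanSpace ℝ (Fin 3)}
  {p₁ p₂ : ℝ → UnitAddTorus (Fin 3) → ℝ}

/-- **Gluing periodic classical solutions of the rotating system, finite window.** Let
`(u₁, p₁)` be a periodic classical solution of the rotating Navier–Stokes system (viscosity `ν`,
Coriolis parameter `Ω`, periodic force `f`) on `(c, T)` and `(u₂, p₂)` one on `(a, b)`,
`c ≤ a < T ≤ b`, with `u₁(t) = u₂(t)` for `t ∈ (a, T)`. Then the velocity equal to `u₁` before `T`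
and to `u₂` from `T` on, with the pressures normalised at the base point `x₀`, is a periodic
classical solution of the rotating system on `(c, b)`: both pieces are torus Navier–Stokes
solutions for the common force `f − Ω e₃ × U`, `U` the glued velocity
(`Torus.isClassicalNSSolutionOn_congr_force`), and `Torus.IsClassicalNSSolutionOn.glue_Ioo`
applies (the restart-and-identify step of BMN 1999, proof of Thm. 5.3, pp. 1170–1171).
[cite: BabinMahalovNicolaenko1999, proof of Thm. 5.3 (pp. 1170–1171)] -/
theorem torus_glue_Ioo {c a T b : ℝ}
    (h₁ : IsClassicalNSCoriolisSolutionOn (Ioo c T) ν Ω (fun t => FunctionSpaces.Torus.lift (f t))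
      (fun t => FunctionSpaces.Torus.lift (u₁ t)) (fun t => FunctionSpaces.Torus.lift (p₁ t)))
    (h₂ : IsClassicalNSCoriolisSolutionOn (Ioo a b) ν Ω (fun t => FunctionSpaces.Torus.lift (f t))
      (fun t => FunctionSpaces.Torus.lift (u₂ t)) (fun t => FunctionSpaces.Torus.lift (p₂ t)))
    (hca : c ≤ a) (haT : a < T) (hTb : T ≤ b) (heq : ∀ t ∈ Ioo a T, u₁ t = u₂ t)
    (x₀ : UnitAddTorus (Fin 3)) :
    IsClassicalNSCoriolisSolutionOn (Ioo c b) ν Ω (fun t => FunctionSpaces.Torus.lift (f t))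
      (fun t => FunctionSpaces.Torus.lift ((fun s => if s < T then u₁ s else u₂ s) t))
      (fun t => FunctionSpaces.Torus.lift
        ((fun s => if s < T then (fun x => p₁ s x - p₁ s x₀) else fun x => p₂ s x - p₂ s x₀) t)) := by
  -- the glued velocity and the common force
  set U : ℝ → UnitAddTorus (Fin 3) → EuclideanSpace ℝ (Fin 3) := fun s => if s < T then u₁ s else u₂ s
    with hU
  have hU₁ : ∀ t ∈ Ioo c T, U t = u₁ t := fun t ht => by simp only [hU, if_pos ht.2]
  have hU₂ : ∀ t ∈ Ioo a b, U t = u₂ t := fun t ht => by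
    by_cases htT : t < T
    · simp only [hU, if_pos htT]
      exact heq t ⟨ht.1, htT⟩
    · simp only [hU, if_neg htT]
  have g₁ : FunctionSpaces.Torus.IsClassicalNSSolutionOn (Ioo c T) ν
      (fun t x => f t x - coriolisForce Ω (U t x)) u₁ p₁ :=
    Torus.isClassicalNSSolutionOn_congr_force h₁.to_torus fun t ht x => by rw [hU₁ t ht]
  have g₂ : FunctionSpaces.Torus.IsClassicalNSSolutionOn (Ioo a b) ν
      (fun t x => f t x - coriolisForce Ω (U t x)) u₂ p₂ :=
    Torus.isClassicalNSSolutionOn_congr_force h₂.to_torus fun t ht x => by rw [hU₂ t ht]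
  have hglue := g₁.glue_Ioo g₂ hca haT hTb heq x₀
  exact of_torus hglue

/-- **Gluing periodic classical solutions of the rotating system, unbounded window**: as
`torus_glue_Ioo` with the second piece on `(a, ∞)` and the conclusion on `(c, ∞)`
(`Torus.IsClassicalNSSolutionOn.glue_Ioi`). [cite: BabinMahalovNicolaenko1999, proof of Thm. 5.3 (pp. 1170–1171)] -/
theorem torus_glue_Ioi {c a T : ℝ}
    (h₁ : IsClassicalNSCoriolisSolutionOn (Ioo c T) ν Ω (fun t => FunctionSpaces.Torus.lift (f t))
      (fun t => FunctionSpaces.Torus.lift (u₁ t)) (fun t => FunctionSpaces.Torus.lift (p₁ t)))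
    (h₂ : IsClassicalNSCoriolisSolutionOn (Ioi a) ν Ω (fun t => FunctionSpaces.Torus.lift (f t))
      (fun t => FunctionSpaces.Torus.lift (u₂ t)) (fun t => FunctionSpaces.Torus.lift (p₂ t)))
    (hca : c ≤ a) (haT : a < T) (heq : ∀ t ∈ Ioo a T, u₁ t = u₂ t) (x₀ : UnitAddTorus (Fin 3)) :
    IsClassicalNSCoriolisSolutionOn (Ioi c) ν Ω (fun t => FunctionSpaces.Torus.lift (f t))
      (fun t => FunctionSpaces.Torus.lift ((fun s => if s < T then u₁ s else u₂ s) t))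
      (fun t => FunctionSpaces.Torus.lift
        ((fun s => if s < T then (fun x => p₁ s x - p₁ s x₀) else fun x => p₂ s x - p₂ s x₀) t)) := by
  set U : ℝ → UnitAddTorus (Fin 3) → EuclideanSpace ℝ (Fin 3) := fun s => if s < T then u₁ s else u₂ s
    with hU
  have hU₁ : ∀ t ∈ Ioo c T, U t = u₁ t := fun t ht => by simp only [hU, if_pos ht.2]
  have hU₂ : ∀ t ∈ Ioi a, U t = u₂ t := fun t ht => by
    by_cases htT : t < T
    · simp only [hU, if_pos htT]
      exact heq t ⟨ht, htT⟩
    · simp only [hU, if_neg htT]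
  have g₁ : FunctionSpaces.Torus.IsClassicalNSSolutionOn (Ioo c T) ν
      (fun t x => f t x - coriolisForce Ω (U t x)) u₁ p₁ :=
    Torus.isClassicalNSSolutionOn_congr_force h₁.to_torus fun t ht x => by rw [hU₁ t ht]
  have g₂ : FunctionSpaces.Torus.IsClassicalNSSolutionOn (Ioi a) ν
      (fun t x => f t x - coriolisForce Ω (U t x)) u₂ p₂ :=
    Torus.isClassicalNSSolutionOn_congr_force h₂.to_torus fun t ht x => by rw [hU₂ t ht]
  have hglue := g₁.glue_Ioi g₂ hca haT heq x₀
  exact of_torus hglue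

end IsClassicalNSCoriolisSolutionOn

end Literature.Analysis.FluidPDE

end
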